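import Mathlib

/-!
# Solo-blind kernel #168 — tail domination for block quadratic forms (head/tail reduction of (H-ineq))

The frozen hypocoercivity inequality (H-ineq) of paper §24.99 is a statement `S ≤ 0` for a banded
Hermitian form on `ℓ²(ℤ)`.  It is certified on the HEAD modes `|m| ≤ M` by interval arithmetic and on
the TAIL by diffusion dominance; the two are glued by the elementary Schur-type estimate recorded here:
if the cross term is bounded by `κ‖x‖‖y‖` and the tail form by `-d‖y‖²` (`d > 0`), then the whole form
is at most the head form plus `κ²/d · ‖x‖²`.
-/

namespace Summit.AnomalousDissipation.AnomalousDissipation.Theorems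

/-- Scalar core: `2κab - d b² ≤ κ² a² / d` for `d > 0` (complete the square). -/
theorem tailDom_scalar (κ d a b : ℝ) (hd : 0 < d) :
    2 * κ * a * b - d * b ^ 2 ≤ κ ^ 2 * a ^ 2 / d := by
  have h : κ ^ 2 * a ^ 2 / d - (2 * κ * a * b - d * b ^ 2) = (κ * a - d * b) ^ 2 / d := by
    field_simp
    ring
  have hnn : 0 ≤ (κ * a - d * b) ^ 2 / d := div_nonneg (sq_nonneg _) hd.le
  linarith

/-- TAIL DOMINATION. A block quadratic form `A x + 2 c x y + D y` whose cross term satisfies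
`|c x y| ≤ κ ‖x‖ ‖y‖` and whose tail block satisfies `D y ≤ -d ‖y‖²` with `d > 0` is bounded by the
head form plus `κ²/d ‖x‖²`. -/
theorem tailDom_form {E F : Type*} [NormedAddCommGroup E] [NormedAddCommGroup F]
    (A : E → ℝ) (c : E → F → ℝ) (D : F → ℝ) (κ d : ℝ) (hd : 0 < d)
    (hc : ∀ x y, |c x y| ≤ κ * ‖x‖ * ‖y‖) (hD : ∀ y, D y ≤ -d * ‖y‖ ^ 2) (x : E) (y : F) :
    A x + 2 * c x y + D y ≤ A x + κ ^ 2 / d * ‖x‖ ^ 2 := by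
  have h1 : c x y ≤ κ * ‖x‖ * ‖y‖ := le_trans (le_abs_self _) (hc x y)
  have h2 := hD y
  have h3 := tailDom_scalar κ d ‖x‖ ‖y‖ hd
  have h4 : κ ^ 2 * ‖x‖ ^ 2 / d = κ ^ 2 / d * ‖x‖ ^ 2 := by ring
  linarith

/-- HEAD CRITERION. If moreover the head form absorbs the Schur correction, `A x ≤ -(κ²/d) ‖x‖²`,
then the whole form is nonpositive — the reduction of (H-ineq) on `ℓ²` to a finite certified block. -/
theorem tailDom_nonpos {E F : Type*} [NormedAddCommGroup E] [NormedAddCommGroup F]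
    (A : E → ℝ) (c : E → F → ℝ) (D : F → ℝ) (κ d : ℝ) (hd : 0 < d)
    (hc : ∀ x y, |c x y| ≤ κ * ‖x‖ * ‖y‖) (hD : ∀ y, D y ≤ -d * ‖y‖ ^ 2)
    (hA : ∀ x, A x ≤ -(κ ^ 2 / d) * ‖x‖ ^ 2) (x : E) (y : F) :
    A x + 2 * c x y + D y ≤ 0 := by
  have h := tailDom_form A c D κ d hd hc hD x y
  have hAx := hA x
  linarith

/-- MARGIN VERSION. With a head margin `A x ≤ -(m + κ²/d) ‖x‖²` and the tail margin split as
`D y ≤ -(m + d) ‖y‖²`, the whole form is bounded by `-m (‖x‖² + ‖y‖²)` — the form in which a certified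
rate `m` on the head and diffusion dominance on the tail give the rate `m` on all of `ℓ²`. -/
theorem tailDom_margin {E F : Type*} [NormedAddCommGroup E] [NormedAddCommGroup F]
    (A : E → ℝ) (c : E → F → ℝ) (D : F → ℝ) (κ d m : ℝ) (hd : 0 < d)
    (hc : ∀ x y, |c x y| ≤ κ * ‖x‖ * ‖y‖) (hD : ∀ y, D y ≤ -(m + d) * ‖y‖ ^ 2)
    (hA : ∀ x, A x ≤ -(m + κ ^ 2 / d) * ‖x‖ ^ 2) (x : E) (y : F) :
    A x + 2 * c x y + D y ≤ -m * (‖x‖ ^ 2 + ‖y‖ ^ 2) := by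
  -- apply the nonpositivity criterion to the shifted forms A' = A + m‖x‖², D' = D + m‖y‖²
  have h := tailDom_nonpos (fun x => A x + m * ‖x‖ ^ 2) c (fun y => D y + m * ‖y‖ ^ 2) κ d hd hc
    (by intro y; have := hD y; nlinarith) (by intro x; have := hA x; nlinarith) x y
  nlinarith [h]

end Summit.AnomalousDissipation.AnomalousDissipation.Theorems
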